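import Summits.BirchSwinnertonDyer.Rank1Residual.Supersingular.KuriharaTwistSymbolDist
import Mathlib.NumberTheory.DirichletCharacter.GaussSum
import HarnessLib

/-!
# The plus symbol in CRT coordinates IV: the TRIVIAL-CHARACTER sum `Σ_{(a,n)=1} P(a/n) = Π_ℓ (A_ℓ − 2)·P(0)`,
# the order-`M` BIN CHARACTERS `χ_j = e_M(j·m(·))` of the discrete logarithms (even, primitive), and
# finite Fourier inversion: the character bins are the DFT of the character sums (KERNEL, abstract half)

Cell `b2b-bsdres`, supersingular family, prover A = unit `b2b-bsdres-x10b` (gen 12).  Topic file; namespaces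
`Summit.BirchSwinnertonDyer.Rank1Residual.Supersingular.KuriharaTwist[.Identity]`.  TOOL THEOREMS of
elementary algebra + three small definitions (`binLogHom`, `binExpHom`, `binChar`: the bin logarithm and the
bin characters of a family of discrete logarithms); no named fact, no elliptic curve, nothing asserted about
any curve, nothing booked; marks unchanged.

HONEST FRAMING (run/shared/lean/b2b/bsd-rank1-residual/, verbatim in every file): the goal of the
cell is to DELETE the COMBINATION-SHAPED residual classes of the Birch–Swinnerton-Dyer formula for
ALL analytic-rank `≤ 1` elliptic curves over `ℚ` — "full BSD formula for every rank `≤ 1` curve in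
class `C`" assembled STRICTLY from published theorems — so that the rank-`≤ 1` remainder becomes
exactly the CONSTRUCTION-SHAPED classes, which are TYPED (missing-input `Prop`s), NOT attempted.
This is not "finishing BSD".

## Why (X6-KURIHARA.md §8.2 (i), §13)

Implementation 3/3c/3d of the Kurihara-number certificates computes the CHARACTER BINS
`C_k = Σ_{a : m(a) = k} [a/n]⁺` of the plus symbol as the finite Fourier transform `C_k = M⁻¹ Σ_j ζ_M^{−jk} S_j`
of the character sums `S_j = Σ_a χ^j(a)[a/n]⁺`, and the `S_j` from twisted central `L`-values (Birch's
formula; `S_0` from `L(E,1)` by the Hecke relation).  This file and its sibling `KuriharaTwistBirch.lean` make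
that formula a tree theorem, so that the chain's one non-kernel input `hball` (`KuriharaTwistRecordAssemblyBall`)
can be restated about NAMED ANALYTIC QUANTITIES (`Ω⁺_f`, `L(E,1)`, `L(f, χ̄_j, 1)`).

## What this file proves (abstract: any `1`-periodic `P : ℚ → ℚ` with the Hecke relation; any `M`, `n`)

* Part A `Identity.sum_units_apply_div_eq_prod_mul` — for `P` `1`-periodic with the Hecke relation
  `A_i·P(r) = Σ_{u mod ℓ_i} P((r+u)/ℓ_i) + P(ℓ_i r)` at distinct primes `ℓ_i` and `n = Π_i ℓ_i`:
  `Σ_{a ∈ (ℤ/n)ˣ} P(a/n) = (Π_i (A_i − 2))·P(0)` (gen 10's norm relation `sum_units_levelArg_update` summed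
  over all tuples — multiplication by the Frobenius tuple permutes them — and inducted over the level; CRT
  transport `unitsEquivPi`, `apply_levelArg_unitsEquivPi`).
* Part B `binLogHom n ψ : (ℤ/n)ˣ →* Multiplicative (ℤ/M)`, `a ↦ Σ_{ℓ∣n} ψ_ℓ(a mod ℓ)` (its `toAdd` is
  LITERALLY the bin index of the records' `hbins`/`hball`, `toAdd_binLogHom_apply`); `binChar n ψ j`, the
  Dirichlet character mod `n` with `χ_j(a) = e_M(j·m(a))` (`e_M = ZMod.stdAddChar`); `binChar_even` (`M` odd:
  `2·m(−1) = 0`), **`binChar_isPrimitive`** (`n` square-free, every `ψ_ℓ` surjective, `j ≠ 0`: a CRT unit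
  `a ≡ g (q)`, `a ≡ 1 (n/q)` with `ψ_q(g) = 1` lies in the kernel of reduction modulo any proper conductor but has
  `χ_j(a) = e_M(j) ≠ 1`; Mathlib `factorsThrough_iff_ker_unitsMap`).
* Part C **`sum_filter_eq_dft`**: for any `T : (ℤ/n)ˣ → ℂ`,
  `Σ_{a : m(a) = k₀} T(a) = M⁻¹ Σ_{j ∈ ℤ/M} e_M(−j k₀) Σ_a χ_j(a) T(a)` (Mathlib `AddChar.sum_mulShift` for the
  primitive character `e_M`).

References: `KuriharaTwistSymbolSystem.lean`, `KuriharaTwistSymbolDist.lean` (gen 10); B. Mazur, J. Tate,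
Duke Math. J. 54 (1987) §1.3 [MazurTate1987]; Mazur–Tate–Teitelbaum, Invent. Math. 84 (1986) §I.8
[MazurTateTeitelbaum1986Invent]; HOME/b2b-bsdres-x10b/X6-KURIHARA.md §8.2, §13.
-/

noncomputable section

open Finset

/-! ## Part A — the trivial-character sum `Σ_{(a,n)=1} P(a/n) = Π_ℓ (A_ℓ − 2) · P(0)` -/

namespace Summit.BirchSwinnertonDyer.Rank1Residual.Supersingular.KuriharaTwist.Identity

section Update

variable {ι : Type*} [DecidableEq ι] (ℓ : ι → ℕ)

/-- `a · (1 with i-th coordinate b) = (a with i-th coordinate a_i·b)`. [folklore] -/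
theorem mul_update_one (a : Π j, (ZMod (ℓ j))ˣ) (i : ι) (b : (ZMod (ℓ i))ˣ) :
    a * Function.update (1 : Π j, (ZMod (ℓ j))ˣ) i b = Function.update a i (a i * b) := by
  funext j
  by_cases h : j = i
  · subst h; simp
  · simp [h]

end Update

section TrivialCharacter

variable {ι : Type*} [Fintype ι] [DecidableEq ι] (ℓ : ι → ℕ) [hℓ : ∀ i, Fact (ℓ i).Prime]
  (hinj : Function.Injective ℓ) (P : ℚ → ℚ) (hper : ∀ (r : ℚ) (z : ℤ), P (r + z) = P r)
  (A : ι → ℤ)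
  (hhecke : ∀ (i : ι) (r : ℚ), (A i : ℚ) * P r =
    ∑ j : Fin (ℓ i), P ((r + ((j : ℕ) : ℚ)) / (ℓ i : ℚ)) + P ((ℓ i : ℚ) * r))

/-- **Fibre count**: `Σ_a Σ_{b ∈ (ℤ/ℓ_i)ˣ} F(a with a_i := b) = #(ℤ/ℓ_i)ˣ · Σ_a F(a)` (reindex `b ↦ a_i·b`,
then `a ↦ a·(1 with i-th coordinate b)` is a bijection for each `b`). [folklore] -/
theorem sum_sum_update_eq {M : Type*} [AddCommMonoid M] (F : (Π j, (ZMod (ℓ j))ˣ) → M) (i : ι) :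
    ∑ a : Π j, (ZMod (ℓ j))ˣ, ∑ b : (ZMod (ℓ i))ˣ, F (Function.update a i b) =
      Fintype.card (ZMod (ℓ i))ˣ • ∑ a : Π j, (ZMod (ℓ j))ˣ, F a := by
  have h1 : ∀ a : Π j, (ZMod (ℓ j))ˣ, ∑ b : (ZMod (ℓ i))ˣ, F (Function.update a i b) =
      ∑ b : (ZMod (ℓ i))ˣ, F (a * Function.update (1 : Π j, (ZMod (ℓ j))ˣ) i b) := fun a =>
    (Fintype.sum_equiv (Equiv.mulLeft (a i)) (fun b => F (a * Function.update (1 : Π j, (ZMod (ℓ j))ˣ) i b))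
      (fun b => F (Function.update a i b)) (fun b => by
        simp only [Equiv.coe_mulLeft, mul_update_one])).symm
  simp_rw [h1]
  rw [Finset.sum_comm]
  have h2 : ∀ b : (ZMod (ℓ i))ˣ,
      ∑ a : Π j, (ZMod (ℓ j))ˣ, F (a * Function.update (1 : Π j, (ZMod (ℓ j))ˣ) i b) =
        ∑ a : Π j, (ZMod (ℓ j))ˣ, F a :=
    fun b => Fintype.sum_equiv (Equiv.mulRight (Function.update (1 : Π j, (ZMod (ℓ j))ˣ) i b)) _ _
      (fun a => rfl)
  simp_rw [h2]
  rw [Finset.sum_const, Finset.card_univ]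

include hinj hper hhecke in
/-- **One induction step**: for `i ∉ U`,
`#(ℤ/ℓ_i)ˣ · Σ_a P(levelArg (insert i U) a) = (A_i − 2) · Σ_a P(levelArg U a)` — the norm relation
`sum_units_levelArg_update` summed over all tuples (multiplication by `frobElt i` permutes the tuples).
[folklore] -/
theorem card_mul_sum_levelArg_insert {U : Finset ι} {i : ι} (hi : i ∉ U) :
    (Fintype.card (ZMod (ℓ i))ˣ : ℚ) * ∑ a : Π j, (ZMod (ℓ j))ˣ, P (levelArg ℓ (insert i U) a) =
      ((A i : ℚ) - 2) * ∑ a : Π j, (ZMod (ℓ j))ˣ, P (levelArg ℓ U a) := by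
  have hmem : i ∈ insert i U := Finset.mem_insert_self i U
  have herase : (insert i U).erase i = U := Finset.erase_insert hi
  have hnorm : ∀ c : Π j, (ZMod (ℓ j))ˣ,
      ∑ b : (ZMod (ℓ i))ˣ, P (levelArg ℓ (insert i U) (Function.update c i b)) =
        A i * P (levelArg ℓ U c) - P (levelArg ℓ U (frobElt ℓ hinj i * c)) -
          P (levelArg ℓ U ((frobElt ℓ hinj i)⁻¹ * c)) := fun c => by
    have h := sum_units_levelArg_update ℓ hinj P hper hmem (hhecke i) c
    rwa [herase] at h
  have hlhs := sum_sum_update_eq ℓ (fun a => P (levelArg ℓ (insert i U) a)) i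
  rw [nsmul_eq_mul] at hlhs
  have hfrob : ∑ c : Π j, (ZMod (ℓ j))ˣ, P (levelArg ℓ U (frobElt ℓ hinj i * c)) =
      ∑ c : Π j, (ZMod (ℓ j))ˣ, P (levelArg ℓ U c) :=
    Fintype.sum_equiv (Equiv.mulLeft (frobElt ℓ hinj i)) _ _ (fun c => rfl)
  have hfrob' : ∑ c : Π j, (ZMod (ℓ j))ˣ, P (levelArg ℓ U ((frobElt ℓ hinj i)⁻¹ * c)) =
      ∑ c : Π j, (ZMod (ℓ j))ˣ, P (levelArg ℓ U c) :=
    Fintype.sum_equiv (Equiv.mulLeft (frobElt ℓ hinj i)⁻¹) _ _ (fun c => rfl)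
  rw [← hlhs, Finset.sum_congr rfl (fun c _ => hnorm c)]
  simp only [Finset.sum_sub_distrib, ← Finset.mul_sum]
  rw [hfrob, hfrob']
  ring

include hinj hper hhecke in
/-- **Induction on the level**: `(Π_{i∈U} #(ℤ/ℓ_i)ˣ) · Σ_a P(levelArg U a) = (Π_{i∈U} (A_i − 2)) · Σ_a P(levelArg ∅ a)`.
[folklore] -/
theorem prod_card_mul_sum_levelArg (U : Finset ι) :
    (∏ i ∈ U, (Fintype.card (ZMod (ℓ i))ˣ : ℚ)) * ∑ a : Π j, (ZMod (ℓ j))ˣ, P (levelArg ℓ U a) =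
      (∏ i ∈ U, ((A i : ℚ) - 2)) * ∑ a : Π j, (ZMod (ℓ j))ˣ, P (levelArg ℓ ∅ a) := by
  induction U using Finset.induction_on with
  | empty => simp
  | @insert i U hi ih =>
    rw [Finset.prod_insert hi, Finset.prod_insert hi, mul_comm (Fintype.card (ZMod (ℓ i))ˣ : ℚ),
      mul_assoc, card_mul_sum_levelArg_insert ℓ hinj P hper A hhecke hi, mul_left_comm, ih, ← mul_assoc]

include hinj hper hhecke in
/-- **THE TRIVIAL-CHARACTER SUM at the full level**: `Σ_{a ∈ Π_i (ℤ/ℓ_i)ˣ} P(levelArg univ a) = (Π_i (A_i − 2)) · P(0)`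
(for the plus symbol of a newform: `Σ_{(a,n)=1} [a/n]⁺ = Π_ℓ (a_ℓ − 2)·[0]⁺`, the Hecke relation at `r = 0`
iterated over the primes of `n`; Mazur–Tate 1987 §1.3, Wiersema–Wuthrich 2022 Lemma 2). [folklore] -/
theorem sum_levelArg_univ_eq_prod_mul :
    ∑ a : Π j, (ZMod (ℓ j))ˣ, P (levelArg ℓ Finset.univ a) = (∏ i, ((A i : ℚ) - 2)) * P 0 := by
  have h := prod_card_mul_sum_levelArg ℓ hinj P hper A hhecke Finset.univ
  have h0 : ∑ a : Π j, (ZMod (ℓ j))ˣ, P (levelArg ℓ ∅ a) =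
      (Fintype.card (Π j, (ZMod (ℓ j))ˣ) : ℚ) * P 0 := by
    simp [levelArg]
  have hcard : (Fintype.card (Π j, (ZMod (ℓ j))ˣ) : ℚ) = ∏ i, (Fintype.card (ZMod (ℓ i))ˣ : ℚ) := by
    rw [Fintype.card_pi, Nat.cast_prod]
  have hne : (∏ i, (Fintype.card (ZMod (ℓ i))ˣ : ℚ)) ≠ 0 :=
    Finset.prod_ne_zero_iff.2 fun i _ => by exact_mod_cast Fintype.card_ne_zero
  rw [h0, hcard] at h
  -- h : (∏ card) * S = (∏ (A-2)) * ((∏ card) * P 0)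
  have h' : (∏ i, (Fintype.card (ZMod (ℓ i))ˣ : ℚ)) * ∑ a : Π j, (ZMod (ℓ j))ˣ, P (levelArg ℓ Finset.univ a) =
      (∏ i, (Fintype.card (ZMod (ℓ i))ˣ : ℚ)) * ((∏ i, ((A i : ℚ) - 2)) * P 0) := by
    rw [h]; ring
  exact mul_left_cancel₀ hne h'

include hinj hper hhecke in
/-- **THE TRIVIAL-CHARACTER SUM ON `(ℤ/n)ˣ`** (`n = Π_i ℓ_i`): `Σ_{a ∈ (ℤ/n)ˣ} P(a/n) = (Π_i (A_i − 2)) · P(0)`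
(CRT transport `unitsEquivPi`, `apply_levelArg_unitsEquivPi`). [folklore] -/
theorem sum_units_apply_div_eq_prod_mul {n : ℕ} [NeZero n] (hn : ∏ i, ℓ i = n) :
    ∑ a : (ZMod n)ˣ, P ((((a : ZMod n).val : ℕ) : ℚ) / (n : ℚ)) = (∏ i, ((A i : ℚ) - 2)) * P 0 := by
  have h1 : ∑ a : (ZMod n)ˣ, P ((((a : ZMod n).val : ℕ) : ℚ) / (n : ℚ)) =
      ∑ b : Π i, (ZMod (ℓ i))ˣ, P (levelArg ℓ Finset.univ b) :=
    Fintype.sum_equiv (unitsEquivPi ℓ hinj n hn).toEquiv _ _ fun a => by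
      simp only [MulEquiv.toEquiv_eq_coe, MulEquiv.coe_toEquiv, apply_levelArg_unitsEquivPi ℓ hinj P hper hn]
  rw [h1, sum_levelArg_univ_eq_prod_mul ℓ hinj P hper A hhecke]

end TrivialCharacter

end Summit.BirchSwinnertonDyer.Rank1Residual.Supersingular.KuriharaTwist.Identity


/-! ## Part B — the order-`M` characters `χ_j = e_M(j · m(·))` attached to the discrete logarithms `ψ_ℓ` -/

namespace Summit.BirchSwinnertonDyer.Rank1Residual.Supersingular.KuriharaTwist

section BinChar

variable {M : ℕ} (n : ℕ) (ψ : (ℓ : ℕ) → (ZMod ℓ)ˣ →* Multiplicative (ZMod M))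

/-- The **bin logarithm** `m : (ℤ/n)ˣ → ℤ/M`, `m(a) = Σ_{ℓ ∣ n} ψ_ℓ(a mod ℓ)`, as a homomorphism into
`Multiplicative (ℤ/M)` (product over the prime factors of `n` of `ψ_ℓ ∘ (reduction mod ℓ)`); its `toAdd` is
the bin index of the twist records (`toAdd_binLogHom_apply`). [folklore] -/
def binLogHom : (ZMod n)ˣ →* Multiplicative (ZMod M) :=
  ∏ ℓ ∈ n.primeFactors.attach, (ψ ℓ.1).comp (ZMod.unitsMap (Nat.dvd_of_mem_primeFactors ℓ.2))

/-- `toAdd (binLogHom n ψ a) = Σ_{ℓ ∣ n} toAdd (ψ_ℓ (a mod ℓ))` — literally the bin index of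
`KuriharaTwistRecordAssembly` / `…AssemblyBall` (`hbins`, `hball`). [folklore] -/
theorem toAdd_binLogHom_apply (a : (ZMod n)ˣ) :
    Multiplicative.toAdd (binLogHom n ψ a) = ∑ ℓ ∈ n.primeFactors.attach,
      Multiplicative.toAdd (ψ ℓ.1 (ZMod.unitsMap (Nat.dvd_of_mem_primeFactors ℓ.2) a)) := by
  rw [binLogHom, MonoidHom.finsetProd_apply, toAdd_prod]
  rfl

variable [NeZero M]

/-- The homomorphism `a ↦ e_M(j · m(a))` into `ℂ` (`e_M = ZMod.stdAddChar`, `x ↦ exp(2πi x/M)`). [folklore] -/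
def binExpHom (j : ZMod M) : (ZMod n)ˣ →* ℂ :=
  ((ZMod.stdAddChar (N := M)).mulShift j).toMonoidHom.comp (binLogHom n ψ)

/-- `binExpHom n ψ j a = e_M(j · m(a))`. [folklore] -/
theorem binExpHom_apply (j : ZMod M) (a : (ZMod n)ˣ) :
    binExpHom n ψ j a = ZMod.stdAddChar (j * Multiplicative.toAdd (binLogHom n ψ a)) := by
  simp [binExpHom, AddChar.toMonoidHom_apply, AddChar.mulShift_apply]

/-- The **`j`-th bin character** `χ_j` modulo `n`: the Dirichlet character with `χ_j(a) = e_M(j · m(a))` on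
units (`binChar_apply_coe`) and `0` on non-units; `χ_1` is the order-`M` character `χ = Π_ℓ ψ_ℓ` of
X6-KURIHARA.md §8.2 (i) and `χ_j = χ^j`. [folklore] -/
def binChar (j : ZMod M) : DirichletCharacter ℂ n :=
  MulChar.ofUnitHom (binExpHom n ψ j).toHomUnits

/-- `χ_j(a) = e_M(j · m(a))` for a unit `a`. [folklore] -/
theorem binChar_apply_coe (j : ZMod M) (a : (ZMod n)ˣ) :
    binChar n ψ j (a : ZMod n) = ZMod.stdAddChar (j * Multiplicative.toAdd (binLogHom n ψ a)) := by
  rw [binChar, MulChar.ofUnitHom_coe, MonoidHom.coe_toHomUnits, binExpHom_apply]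

/-- `χ_0(a) = 1` for a unit `a`. [folklore] -/
theorem binChar_zero_apply_coe (a : (ZMod n)ˣ) : binChar n ψ 0 (a : ZMod n) = 1 := by
  rw [binChar_apply_coe, zero_mul, AddChar.map_zero_eq_one]

omit [NeZero M] in
/-- `m(−1) = 0` when `M` is odd: `2·m(−1) = m(1) = 0` and `2` is invertible modulo `M`. [folklore] -/
theorem toAdd_binLogHom_neg_one (hM : Odd M) : Multiplicative.toAdd (binLogHom n ψ (-1)) = 0 := by
  have h2 : binLogHom n ψ (-1) * binLogHom n ψ (-1) = 1 := by
    rw [← map_mul, neg_mul_neg, one_mul, map_one]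
  have h2' : (2 : ZMod M) * Multiplicative.toAdd (binLogHom n ψ (-1)) = 0 := by
    rw [two_mul, ← toAdd_mul, h2, toAdd_one]
  have hu : IsUnit ((2 : ℕ) : ZMod M) :=
    (ZMod.isUnit_iff_coprime 2 M).2 (Nat.coprime_two_left.2 hM)
  rw [Nat.cast_ofNat] at hu
  exact (hu.mul_right_eq_zero).1 h2'

/-- **`χ_j` is even** when `M` is odd (`χ_j(−1) = e_M(j · m(−1)) = e_M(0) = 1`). [folklore] -/
theorem binChar_even (hM : Odd M) (j : ZMod M) : (binChar n ψ j).Even := by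
  unfold DirichletCharacter.Even
  rw [show (-1 : ZMod n) = ((-1 : (ZMod n)ˣ) : ZMod n) by simp, binChar_apply_coe,
    toAdd_binLogHom_neg_one n ψ hM, mul_zero, AddChar.map_zero_eq_one]

/-- **`χ_j` is primitive** (conductor `n`) when `n` is square-free, every `ψ_ℓ`, `ℓ ∣ n`, is surjective and
`j ≠ 0` in `ℤ/M`: if `χ_j` factored through a proper divisor `d` of `n`, some prime `q ∣ n` has `q ∤ d`, so
`d ∣ n/q`; a unit `a ≡ g (mod q)`, `a ≡ 1 (mod n/q)` with `ψ_q(g) = 1 ∈ ℤ/M` (Chinese remainder) lies in the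
kernel of reduction modulo `d` but has `χ_j(a) = e_M(j) ≠ 1`. [folklore] -/
theorem binChar_isPrimitive [NeZero n] (hsq : Squarefree n)
    (hψ : ∀ ℓ ∈ n.primeFactors, Function.Surjective (ψ ℓ)) {j : ZMod M} (hj : j ≠ 0) :
    (binChar n ψ j).IsPrimitive := by
  classical
  -- the prime-factor family of `n` and CRT on units
  haveI hF : ∀ i : ↥n.primeFactors, Fact ((i : ℕ)).Prime :=
    fun i => ⟨Nat.prime_of_mem_primeFactors i.2⟩
  have hn : ∏ i : ↥n.primeFactors, (i : ℕ) = n :=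
    (Finset.prod_coe_sort n.primeFactors (fun x : ℕ => x)).trans (Nat.prod_primeFactors_of_squarefree hsq)
  set d := (binChar n ψ j).conductor with hd_def
  have hd : d ∣ n := DirichletCharacter.conductor_dvd_level _
  by_contra hne
  change d ≠ n at hne
  -- a prime `q ∣ n` with `q ∤ d`
  obtain ⟨q, hq, hqd⟩ : ∃ q ∈ n.primeFactors, ¬ q ∣ d := by
    by_contra h
    push Not at h
    apply hne
    refine Nat.dvd_antisymm hd ?_
    rw [← Nat.prod_primeFactors_of_squarefree hsq]
    exact Finset.prod_primes_dvd d (fun p hp => (Nat.prime_of_mem_primeFactors hp).prime) h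
  have hqp : q.Prime := Nat.prime_of_mem_primeFactors hq
  -- a unit `g mod q` with `ψ_q(g) = 1` and the CRT unit `a ≡ g (q)`, `a ≡ 1 (ℓ ≠ q)`
  obtain ⟨g, hg⟩ := hψ q hq (Multiplicative.ofAdd 1)
  let e := Identity.unitsEquivPi (fun i : ↥n.primeFactors => (i : ℕ)) Subtype.val_injective n hn
  let t : Π i : ↥n.primeFactors, (ZMod (i : ℕ))ˣ :=
    Function.update (1 : Π i : ↥n.primeFactors, (ZMod (i : ℕ))ˣ) ⟨q, hq⟩ g
  let a : (ZMod n)ˣ := e.symm t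
  have ha : ∀ i : ↥n.primeFactors, ZMod.unitsMap (Nat.dvd_of_mem_primeFactors i.2) a = t i := fun i => by
    rw [← Identity.unitsEquivPi_apply (fun i : ↥n.primeFactors => (i : ℕ)) Subtype.val_injective hn a i]
    exact congrFun (e.apply_symm_apply t) i
  -- `χ_j(a) = e_M(j)`
  have hval : binChar n ψ j (a : ZMod n) = ZMod.stdAddChar j := by
    rw [binChar_apply_coe, toAdd_binLogHom_apply]
    have hsum : ∑ ℓ ∈ n.primeFactors.attach, Multiplicative.toAdd
        (ψ ℓ.1 (ZMod.unitsMap (Nat.dvd_of_mem_primeFactors ℓ.2) a)) = 1 := by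
      rw [← Finset.sum_erase_add _ _ (Finset.mem_attach _ ⟨q, hq⟩)]
      have hrest : ∑ ℓ ∈ n.primeFactors.attach.erase ⟨q, hq⟩, Multiplicative.toAdd
          (ψ ℓ.1 (ZMod.unitsMap (Nat.dvd_of_mem_primeFactors ℓ.2) a)) = 0 := by
        refine Finset.sum_eq_zero fun i hi => ?_
        have hiq : i ≠ ⟨q, hq⟩ := (Finset.mem_erase.1 hi).1
        rw [ha i, show t i = 1 from Function.update_of_ne hiq _ _, map_one, toAdd_one]
      rw [hrest, zero_add, ha ⟨q, hq⟩, show t ⟨q, hq⟩ = g from Function.update_self _ _ _, hg, toAdd_ofAdd]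
    rw [hsum, mul_one]
  -- `a ≡ 1 (mod d)`: every prime `ℓ ∣ n`, `ℓ ≠ q`, divides `a − 1`, hence so does `n/q`, and `d ∣ n/q`
  have hdvd : ∀ i : ↥n.primeFactors, i ≠ ⟨q, hq⟩ → ((i : ℕ) : ℤ) ∣ (((a : ZMod n).val : ℕ) : ℤ) - 1 := by
    intro i hiq
    have h1 : ((ZMod.unitsMap (Nat.dvd_of_mem_primeFactors i.2) a : (ZMod (i : ℕ))ˣ) : ZMod (i : ℕ)) = 1 := by
      rw [ha i, show t i = 1 from Function.update_of_ne hiq _ _, Units.val_one]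
    have h2 : ((ZMod.unitsMap (Nat.dvd_of_mem_primeFactors i.2) a : (ZMod (i : ℕ))ˣ) : ZMod (i : ℕ)) =
        ((((a : ZMod n).val : ℕ) : ℤ) : ZMod (i : ℕ)) := by
      rw [ZMod.unitsMap_def, Units.coe_map, MonoidHom.coe_coe, ZMod.castHom_apply, ZMod.cast_eq_val]
      push_cast
      rfl
    rw [h2] at h1
    have h3 : ((1 : ℤ) : ZMod (i : ℕ)) = ((((a : ZMod n).val : ℕ) : ℤ) : ZMod (i : ℕ)) := by
      rw [h1, Int.cast_one]
    exact (ZMod.intCast_eq_intCast_iff_dvd_sub _ _ _).1 h3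
  have hprod : (∏ i ∈ (Finset.univ : Finset ↥n.primeFactors).erase ⟨q, hq⟩, ((i : ℕ) : ℤ)) ∣
      (((a : ZMod n).val : ℕ) : ℤ) - 1 := by
    refine Finset.prod_dvd_of_coprime ?_ (fun i hi => hdvd i (Finset.mem_erase.1 hi).1)
    intro i _ i' _ hii'
    exact Nat.isCoprime_iff_coprime.2
      ((Nat.coprime_primes (hF i).out (hF i').out).2 (fun h => hii' (Subtype.ext h)))
  have hnq : (q : ℤ) * (∏ i ∈ (Finset.univ : Finset ↥n.primeFactors).erase ⟨q, hq⟩, ((i : ℕ) : ℤ)) = n := by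
    have h : ((⟨q, hq⟩ : ↥n.primeFactors) : ℕ) *
        ∏ i ∈ (Finset.univ : Finset ↥n.primeFactors).erase ⟨q, hq⟩, (i : ℕ) = n := by
      rw [Finset.mul_prod_erase (Finset.univ : Finset ↥n.primeFactors) (fun i : ↥n.primeFactors => (i : ℕ))
        (Finset.mem_univ ⟨q, hq⟩), hn]
    exact_mod_cast h
  have hdn' : (d : ℤ) ∣ ∏ i ∈ (Finset.univ : Finset ↥n.primeFactors).erase ⟨q, hq⟩, ((i : ℕ) : ℤ) := by
    have hcop : IsCoprime (d : ℤ) (q : ℤ) :=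
      Nat.isCoprime_iff_coprime.2 ((Nat.Prime.coprime_iff_not_dvd hqp).2 hqd).symm
    have hdn : (d : ℤ) ∣ (q : ℤ) *
        ∏ i ∈ (Finset.univ : Finset ↥n.primeFactors).erase ⟨q, hq⟩, ((i : ℕ) : ℤ) := by
      rw [hnq]; exact_mod_cast hd
    exact hcop.dvd_of_dvd_mul_left hdn
  have had : ZMod.unitsMap hd a = 1 := by
    apply Units.ext
    rw [ZMod.unitsMap_def, Units.coe_map, MonoidHom.coe_coe, ZMod.castHom_apply, ZMod.cast_eq_val,
      Units.val_one]
    have h := (ZMod.intCast_eq_intCast_iff_dvd_sub (1 : ℤ) ((((a : ZMod n).val : ℕ) : ℤ)) d).2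
      (hdn'.trans hprod)
    push_cast at h
    exact h.symm
  -- but `χ_j` factors through its conductor `d`: contradiction with `e_M(j) ≠ 1`
  have hfac := (DirichletCharacter.factorsThrough_iff_ker_unitsMap hd).1
    (DirichletCharacter.factorsThrough_conductor (binChar n ψ j))
  have hker : a ∈ (MulChar.toUnitHom (binChar n ψ j)).ker := hfac (by rw [MonoidHom.mem_ker, had])
  rw [MonoidHom.mem_ker] at hker
  have h1 : binChar n ψ j (a : ZMod n) = 1 := by
    rw [← MulChar.coe_toUnitHom, hker, Units.val_one]
  rw [hval] at h1
  exact hj (((ZMod.isPrimitive_stdAddChar M).zmod_char_eq_one_iff M j).1 h1)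

end BinChar

/-! ## Part C — finite Fourier inversion: the bins are the DFT of the character sums -/

section DFT

variable {M : ℕ} [NeZero M] (n : ℕ) [NeZero n]
  (ψ : (ℓ : ℕ) → (ZMod ℓ)ˣ →* Multiplicative (ZMod M))

/-- **The character bins are the finite Fourier transform of the character sums** (orthogonality of the
additive characters of `ℤ/M`, Mathlib `AddChar.sum_mulShift`): for any `T : (ℤ/n)ˣ → ℂ` and `k₀ ∈ ℤ/M`,
`Σ_{a : m(a) = k₀} T(a) = M⁻¹ · Σ_{j ∈ ℤ/M} e_M(−j k₀) · Σ_a χ_j(a) T(a)` — formula (i) `C_k = p⁻¹ Σ_j ζ^{−jk} S_j`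
of X6-KURIHARA.md §8.2. [folklore] -/
theorem sum_filter_eq_dft (T : (ZMod n)ˣ → ℂ) (k₀ : ZMod M) :
    ∑ a ∈ (Finset.univ : Finset (ZMod n)ˣ).filter (fun a => Multiplicative.toAdd (binLogHom n ψ a) = k₀),
        T a =
      (M : ℂ)⁻¹ * ∑ j : ZMod M, ZMod.stdAddChar (-(j * k₀)) *
        ∑ a : (ZMod n)ˣ, binChar n ψ j (a : ZMod n) * T a := by
  classical
  have hM : (M : ℂ) ≠ 0 := by exact_mod_cast NeZero.ne M
  -- rewrite the inner products as `e_M(j · (m(a) − k₀)) · T(a)` and swap the sums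
  have hinner : ∀ j : ZMod M, ZMod.stdAddChar (-(j * k₀)) *
      ∑ a : (ZMod n)ˣ, binChar n ψ j (a : ZMod n) * T a =
      ∑ a : (ZMod n)ˣ, ZMod.stdAddChar (j * (Multiplicative.toAdd (binLogHom n ψ a) - k₀)) * T a := by
    intro j
    rw [Finset.mul_sum]
    refine Finset.sum_congr rfl fun a _ => ?_
    rw [binChar_apply_coe, ← mul_assoc, ← AddChar.map_add_eq_mul]
    congr 2
    ring
  simp_rw [hinner]
  rw [Finset.sum_comm]
  have horth : ∀ a : (ZMod n)ˣ,
      ∑ j : ZMod M, ZMod.stdAddChar (j * (Multiplicative.toAdd (binLogHom n ψ a) - k₀)) * T a =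
      (if Multiplicative.toAdd (binLogHom n ψ a) = k₀ then (M : ℂ) else 0) * T a := by
    intro a
    rw [← Finset.sum_mul, AddChar.sum_mulShift _ (ZMod.isPrimitive_stdAddChar M), ZMod.card]
    by_cases h : Multiplicative.toAdd (binLogHom n ψ a) = k₀
    · rw [if_pos (sub_eq_zero.2 h), if_pos h]
    · rw [if_neg (fun h' => h (sub_eq_zero.1 h')), if_neg h, Nat.cast_zero]
  simp_rw [horth]
  rw [Finset.sum_filter, Finset.mul_sum]
  refine Finset.sum_congr rfl fun a _ => ?_
  split_ifs with h
  · rw [← mul_assoc, inv_mul_cancel₀ hM, one_mul]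
  · rw [zero_mul, mul_zero]

end DFT

end Summit.BirchSwinnertonDyer.Rank1Residual.Supersingular.KuriharaTwist

end
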